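import Summits.ResolutionOfSingularities.ResolutionOfSingularities.Theorems.FrobeniusLadderFRationalResolutionChartAlgebraOrthantPoints
import Summits.ResolutionOfSingularities.ResolutionOfSingularities.Theorems.FrobeniusLadderFRationalResolutionChartAlgebraTower
import Summits.ResolutionOfSingularities.ResolutionOfSingularities.Theorems.FrobeniusLadderFRationalResolutionVertexChartBlowup
import Summits.ResolutionOfSingularities.ResolutionOfSingularities.Theorems.FrobeniusLadderFRationalResolutionAdaptedBasisOrthant
import HarnessLib

/-!
# Crux `FrobeniusLadder.FRationalResolution` (stmt-ResolutionOfSingularities-15317), line `redirect`,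
# stub `stub_diagonalizableQuotientResolution` — **one round of the point-blow-up recursion at the ring
# level, I: the blow-up charts of the fixed point of a vertex chart algebra are chart algebras over the
# original base, and the `x`-chart is regular over `𝔭`** (surface case over arbitrary fields, memo
# MEMO-15317-leafhand2-g6 §3–§4 / MEMO-15317-leafhand2-g7; assembles `…ChartAlgebraTower`,
# `…VertexChartBlowup`, `…AdaptedBasisOrthant`, `…ChartAlgebraOrthantPoints`)

Setting: `φ : P → A` an fs spanning chart on a Noetherian ring, log regular at `𝔭`, `L = ℤF_𝔭`;
`C = A[χ(Q)]` a chart algebra over it ((χ), (gen), (D), (K), (Ω)) with `Q` a vertex chart monoid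
`L + {m v + l x : m ≥ 0, m + c l ≥ 0}`, `c ≥ 2`, `y = c v − x`. The blow-up of `Spec C` along
`(χ(v), χ(x), χ(y))` (= the ideal of `χ(Q ∖ L)`, `…VertexChartBlowup.span_chi_three_eq`) is covered by
the affine blowup algebras `C_a = C[I/χ(a)]`, `a ∈ {v, x, y}`, with charts `χ_a = LogChart.blowupChart`.

* `blowupChartMonoid_fg`, `three_finite` — finiteness bookkeeping;
* `tower_pack` — each `C_a` is a chart algebra OVER THE ORIGINAL `(A, P, φ)` ((gen), (D), (K), (Ω);
  (χ) is `…ChartAlgebraTower.tower_chi`);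
* **`isRegularLocalRing_xChart`** — every prime of `C_x` over `𝔭` is regular (monoid `L ⊕ ℕx ⊕ ℕ(v − x)`
  orthant-like, Kato (10.3) one prime at a time). The `y`-chart is the `x`-chart of the symmetric data
  (`…VertexChartBlowup.mem_blowupChartMonoid_y_iff`).

Part II (`…VertexChartBlowupStep`): the `v`-chart. Honest label: assembly toward ONE leaf stub (no stub,
crux or summit closed). No definitions, no named facts, no sorry. [cite: Kato1994, (10.1), (10.3)]
[cite: Niziol2006, §4]
-/

noncomputable section

-- single-problem summit: the doubled namespace component is forced
set_option linter.dupNamespace false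

open IsLocalRing Literature.AlgebraicGeometry.Resolution Literature.AlgebraicGeometry.Resolution.LogChart
  Literature.AlgebraicGeometry.Resolution.LogRefinedChart
open Summit.ResolutionOfSingularities.ResolutionOfSingularities.Theorems.FRationalResolution.ChartAlgebraTower
open Summit.ResolutionOfSingularities.ResolutionOfSingularities.Theorems.FRationalResolution.ChartAlgebraOrthantPoints
open Summit.ResolutionOfSingularities.ResolutionOfSingularities.Theorems.FRationalResolution.VertexChartMonoid
open Summit.ResolutionOfSingularities.ResolutionOfSingularities.Theorems.FRationalResolution.VertexChartBlowup
open Summit.ResolutionOfSingularities.ResolutionOfSingularities.Theorems.FRationalResolution.AdaptedBasisOrthant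

namespace Summit.ResolutionOfSingularities.ResolutionOfSingularities.Theorems.FRationalResolution.VertexChartBlowupCharts

universe u

variable {A : Type u} [CommRing A] [IsNoetherianRing A] {n : ℕ} {P : AddSubmonoid (Fin n → ℤ)}
  {φ : Multiplicative P →* A} {𝔭 : Ideal A} [𝔭.IsPrime] {C : Type u} [CommRing C] [Algebra A C]
  {Q : AddSubmonoid (Fin n → ℤ)} {χ : Multiplicative Q →* C} {v x : Fin n → ℤ} {c : ℕ}

/-! ### Finiteness and the tower -/

omit [IsNoetherianRing A] [𝔭.IsPrime] in
/-- Blow-up chart monoids along finite sets of a finitely generated monoid are finitely generated.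
[folklore] -/
theorem blowupChartMonoid_fg (hQ : Q.FG) {s : Set Q} (hs : s.Finite) (a : Q) :
    (blowupChartMonoid Q s a).FG := by
  classical
  obtain ⟨S, hS⟩ := hQ
  refine ⟨S ∪ (hs.toFinset.image fun g : Q => (g : Fin n → ℤ) - a), ?_⟩
  unfold blowupChartMonoid
  apply le_antisymm
  · refine AddSubmonoid.closure_le.2 ?_
    intro w hw
    rw [Finset.coe_union, Finset.coe_image, Set.Finite.coe_toFinset] at hw
    rcases hw with hw | hw
    · exact AddSubmonoid.subset_closure (Or.inl (hS ▸ AddSubmonoid.subset_closure hw))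
    · exact AddSubmonoid.subset_closure (Or.inr hw)
  · refine AddSubmonoid.closure_le.2 ?_
    rintro w (hw | hw)
    · rw [← hS] at hw
      refine AddSubmonoid.closure_mono ?_ hw
      rw [Finset.coe_union]; exact Set.subset_union_left
    · refine AddSubmonoid.subset_closure ?_
      rw [Finset.coe_union, Finset.coe_image, Set.Finite.coe_toFinset]
      exact Or.inr hw

omit [IsNoetherianRing A] [𝔭.IsPrime] in
/-- The set of the three monomials is finite. [folklore] -/
theorem three_finite :
    ({q : Q | (q : Fin n → ℤ) = v ∨ (q : Fin n → ℤ) = x ∨ (q : Fin n → ℤ) = (c : ℤ) • v - x} : Set Q).Finite := by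
  have h : ({q : Q | (q : Fin n → ℤ) = v ∨ (q : Fin n → ℤ) = x ∨ (q : Fin n → ℤ) = (c : ℤ) • v - x} : Set Q)
      = Subtype.val ⁻¹' ({v, x, (c : ℤ) • v - x} : Set (Fin n → ℤ)) := by
    ext q; simp
  rw [h]
  exact (Set.toFinite _).preimage Subtype.val_injective.injOn

omit [IsNoetherianRing A] [𝔭.IsPrime] in
/-- **The blow-up charts of a chart algebra are chart algebras over the original base**: (gen), (D),
(K), (Ω) for `C_a = C[I/χ(a)]` with the chart `χ_a = blowupChart Q χ s a`. [folklore] -/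
theorem tower_pack (hPQ : P ≤ Q)
    (hχ : ∀ p : P, χ (Multiplicative.ofAdd ⟨(p : Fin n → ℤ), hPQ p.2⟩) =
      algebraMap A C (φ (Multiplicative.ofAdd p)))
    (hgen : Algebra.adjoin A (Set.range χ) = ⊤)
    (hD : ∀ q ∈ Q, ∃ p ∈ P, q + p ∈ P)
    (hK : ∀ a : A, algebraMap A C a = 0 → ∃ p : P, φ (Multiplicative.ofAdd p) * a = 0)
    (hΩ : ∀ (K : Type u) [Field K] (g : A →+* K), (∀ p : P, g (φ (Multiplicative.ofAdd p)) ≠ 0) →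
      ∃ ω : C →+* K, ω.comp (algebraMap A C) = g)
    (s : Set Q) (a : Q) :
    Algebra.adjoin A (Set.range (blowupChart Q χ s a)) = ⊤ ∧
    (∀ q ∈ blowupChartMonoid Q s a, ∃ p ∈ P, q + p ∈ P) ∧
    (∀ r : A, algebraMap A (blowupAlgebra (Ideal.span ((fun q : Q => χ (Multiplicative.ofAdd q)) '' s))
        (χ (Multiplicative.ofAdd a))) r = 0 → ∃ p : P, φ (Multiplicative.ofAdd p) * r = 0) ∧
    (∀ (K : Type u) [Field K] (g : A →+* K), (∀ p : P, g (φ (Multiplicative.ofAdd p)) ≠ 0) →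
      ∃ ω : blowupAlgebra (Ideal.span ((fun q : Q => χ (Multiplicative.ofAdd q)) '' s))
        (χ (Multiplicative.ofAdd a)) →+* K, ω.comp (algebraMap A _) = g) := by
  have hχ₂ := blowupChart_of_mem Q χ s a
  refine ⟨?_, ?_, ?_, ?_⟩
  · exact tower_adjoin_eq_top hgen (le_blowupChartMonoid Q s a) hχ₂ (adjoin_range_blowupChart_eq_top Q χ s a)
  · exact tower_denominators hPQ hD (exists_add_mem_of_mem_blowupChartMonoid s a)
  · exact tower_kernel hPQ hχ hD hK
      (fun r hr => exists_map_mul_eq_zero_of_algebraMap_blowupAlgebra_eq_zero (φ := χ) _ a r hr)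
  · exact tower_fieldExtension hPQ hχ hD hΩ
      (fun K _ g hg => exists_ringHom_blowupAlgebra_comp_eq (φ := χ) _ a K g hg)

/-! ### The chart at `x` is regular over `𝔭` -/

/-- **The `x`-chart of the blow-up of the fixed point is regular at every prime over `𝔭`.** Its chart
monoid is `L ⊕ ℕx ⊕ ℕ(v − x)` (`…VertexChartBlowup.mem_blowupChartMonoid_x_iff`), orthant-like
(`…AdaptedBasisOrthant`), so Kato (10.3) applies (`…ChartAlgebraOrthantPoints`).
[cite: Kato1994, (10.1), (10.3)] -/
theorem isRegularLocalRing_xChart (hc : 2 ≤ c) (hP : P.FG)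
    (hsat : ∀ (w : Fin n → ℤ) (k : ℕ), 0 < k → k • w ∈ P → w ∈ P)
    (hspanP : Submodule.span ℤ (P : Set (Fin n → ℤ)) = ⊤) (hPQ : P ≤ Q)
    (hχ : ∀ p : P, χ (Multiplicative.ofAdd ⟨(p : Fin n → ℤ), hPQ p.2⟩) =
      algebraMap A C (φ (Multiplicative.ofAdd p)))
    (hgen : Algebra.adjoin A (Set.range χ) = ⊤)
    (hD : ∀ q ∈ Q, ∃ p ∈ P, q + p ∈ P)
    (hK : ∀ a : A, algebraMap A C a = 0 → ∃ p : P, φ (Multiplicative.ofAdd p) * a = 0)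
    (hΩ : ∀ (K : Type u) [Field K] (g : A →+* K), (∀ p : P, g (φ (Multiplicative.ofAdd p)) ≠ 0) →
      ∃ ω : C →+* K, ω.comp (algebraMap A C) = g)
    (hQ : ∀ w, w ∈ Q ↔ ∃ g ∈ Submodule.span ℤ (faceMonoid P φ 𝔭 : Set (Fin n → ℤ)), ∃ m l : ℤ,
      0 ≤ m ∧ 0 ≤ m + (c : ℤ) * l ∧ w = g + m • v + l • x)
    (hind : ∀ g ∈ Submodule.span ℤ (faceMonoid P φ 𝔭 : Set (Fin n → ℤ)), ∀ m l : ℤ,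
      g + m • v + l • x = 0 → m = 0 ∧ l = 0)
    (hspan : ∀ w : Fin n → ℤ, ∃ g ∈ Submodule.span ℤ (faceMonoid P φ 𝔭 : Set (Fin n → ℤ)),
      ∃ m l : ℤ, w = g + m • v + l • x)
    (hreg : IsLogRegularAt P φ 𝔭) (hx : x ∈ Q)
    (𝔔 : Ideal (blowupAlgebra (Ideal.span ((fun q : Q => χ (Multiplicative.ofAdd q)) ''
        {q : Q | (q : Fin n → ℤ) = v ∨ (q : Fin n → ℤ) = x ∨ (q : Fin n → ℤ) = (c : ℤ) • v - x}))
        (χ (Multiplicative.ofAdd ⟨x, hx⟩)))) [𝔔.IsPrime]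
    (h𝔔 : 𝔔.comap (algebraMap A _) = 𝔭) :
    IsRegularLocalRing (Localization.AtPrime 𝔔) := by
  obtain ⟨hgen₂, hD₂, -, hΩ₂⟩ := tower_pack hPQ hχ hgen hD hK hΩ
    {q : Q | (q : Fin n → ℤ) = v ∨ (q : Fin n → ℤ) = x ∨ (q : Fin n → ℤ) = (c : ℤ) • v - x} ⟨x, hx⟩
  have hχ₂ := tower_chi hPQ hχ (le_blowupChartMonoid Q {q : Q | (q : Fin n → ℤ) = v ∨ (q : Fin n → ℤ) = x ∨ (q : Fin n → ℤ) = (c : ℤ) • v - x} ⟨x, hx⟩) (blowupChart_of_mem Q χ {q : Q | (q : Fin n → ℤ) = v ∨ (q : Fin n → ℤ) = x ∨ (q : Fin n → ℤ) = (c : ℤ) • v - x} ⟨x, hx⟩)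
  -- the chart monoid `L ⊕ ℕx ⊕ ℕ(v − x)` is orthant-like
  have hind' : ∀ g ∈ Submodule.span ℤ (faceMonoid P φ 𝔭 : Set (Fin n → ℤ)), ∀ m l : ℤ,
      g + m • x + l • (v - x) = 0 → m = 0 ∧ l = 0 := by
    intro g hg m l h
    have h1 : g + l • v + (m - l) • x = 0 := by rw [← h]; module
    have := hind g hg _ _ h1
    omega
  have hspan' : ∀ w : Fin n → ℤ, ∃ g ∈ Submodule.span ℤ (faceMonoid P φ 𝔭 : Set (Fin n → ℤ)),
      ∃ m l : ℤ, w = g + m • x + l • (v - x) := by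
    intro w
    obtain ⟨g, hg, m, l, rfl⟩ := hspan w
    exact ⟨g, hg, m + l, m, by module⟩
  obtain ⟨b, I, hI⟩ := exists_isOrthantLike_of_mem_iff (Q := blowupChartMonoid Q {q : Q | (q : Fin n → ℤ) = v ∨ (q : Fin n → ℤ) = x ∨ (q : Fin n → ℤ) = (c : ℤ) • v - x} ⟨x, hx⟩) hind' hspan'
    Finset.univ (fun w => by
      rw [mem_blowupChartMonoid_x_iff hc hQ hind hx w]
      constructor
      · rintro ⟨g, hg, m, l, hm, hl, h⟩; exact ⟨g, hg, m, l, fun _ => hm, fun _ => hl, h⟩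
      · rintro ⟨g, hg, m, l, hm, hl, h⟩
        exact ⟨g, hg, m, l, hm (Finset.mem_univ _), hl (Finset.mem_univ _), h⟩)
  have hreg' : IsLogRegularAt P φ (𝔔.comap (algebraMap A _)) := by
    have key : ∀ (𝔮 : Ideal A) [𝔮.IsPrime], 𝔮 = 𝔭 → IsLogRegularAt P φ 𝔮 := by
      intro 𝔮 _ h; subst h; exact hreg
    exact key _ h𝔔
  exact isRegularLocalRing_localization_of_isOrthantLike hP hsat hspanP hI
    (hPQ.trans (le_blowupChartMonoid Q {q : Q | (q : Fin n → ℤ) = v ∨ (q : Fin n → ℤ) = x ∨ (q : Fin n → ℤ) = (c : ℤ) • v - x} ⟨x, hx⟩)) hχ₂ hgen₂ hΩ₂ 𝔔 hreg'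

/-! ### The chart at `y` is regular over `𝔭` -/

/-- **The `y`-chart of the blow-up of the fixed point is regular at every prime over `𝔭`** (its chart
monoid is `L ⊕ ℕy ⊕ ℕ(v − y)`, `…VertexChartBlowup.mem_blowupChartMonoid_y_iff`).
[cite: Kato1994, (10.1), (10.3)] -/
theorem isRegularLocalRing_yChart (hc : 2 ≤ c) (hP : P.FG)
    (hsat : ∀ (w : Fin n → ℤ) (k : ℕ), 0 < k → k • w ∈ P → w ∈ P)
    (hspanP : Submodule.span ℤ (P : Set (Fin n → ℤ)) = ⊤) (hPQ : P ≤ Q)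
    (hχ : ∀ p : P, χ (Multiplicative.ofAdd ⟨(p : Fin n → ℤ), hPQ p.2⟩) =
      algebraMap A C (φ (Multiplicative.ofAdd p)))
    (hgen : Algebra.adjoin A (Set.range χ) = ⊤)
    (hD : ∀ q ∈ Q, ∃ p ∈ P, q + p ∈ P)
    (hK : ∀ a : A, algebraMap A C a = 0 → ∃ p : P, φ (Multiplicative.ofAdd p) * a = 0)
    (hΩ : ∀ (K : Type u) [Field K] (g : A →+* K), (∀ p : P, g (φ (Multiplicative.ofAdd p)) ≠ 0) →
      ∃ ω : C →+* K, ω.comp (algebraMap A C) = g)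
    (hQ : ∀ w, w ∈ Q ↔ ∃ g ∈ Submodule.span ℤ (faceMonoid P φ 𝔭 : Set (Fin n → ℤ)), ∃ m l : ℤ,
      0 ≤ m ∧ 0 ≤ m + (c : ℤ) * l ∧ w = g + m • v + l • x)
    (hind : ∀ g ∈ Submodule.span ℤ (faceMonoid P φ 𝔭 : Set (Fin n → ℤ)), ∀ m l : ℤ,
      g + m • v + l • x = 0 → m = 0 ∧ l = 0)
    (hspan : ∀ w : Fin n → ℤ, ∃ g ∈ Submodule.span ℤ (faceMonoid P φ 𝔭 : Set (Fin n → ℤ)),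
      ∃ m l : ℤ, w = g + m • v + l • x)
    (hreg : IsLogRegularAt P φ 𝔭) (hy : (c : ℤ) • v - x ∈ Q)
    (𝔔 : Ideal (blowupAlgebra (Ideal.span ((fun q : Q => χ (Multiplicative.ofAdd q)) ''
        {q : Q | (q : Fin n → ℤ) = v ∨ (q : Fin n → ℤ) = x ∨ (q : Fin n → ℤ) = (c : ℤ) • v - x}))
        (χ (Multiplicative.ofAdd ⟨(c : ℤ) • v - x, hy⟩)))) [𝔔.IsPrime]
    (h𝔔 : 𝔔.comap (algebraMap A _) = 𝔭) :
    IsRegularLocalRing (Localization.AtPrime 𝔔) := by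
  obtain ⟨hgen₂, hD₂, -, hΩ₂⟩ := tower_pack hPQ hχ hgen hD hK hΩ
    {q : Q | (q : Fin n → ℤ) = v ∨ (q : Fin n → ℤ) = x ∨ (q : Fin n → ℤ) = (c : ℤ) • v - x} ⟨(c : ℤ) • v - x, hy⟩
  have hχ₂ := tower_chi hPQ hχ (le_blowupChartMonoid Q {q : Q | (q : Fin n → ℤ) = v ∨ (q : Fin n → ℤ) = x ∨ (q : Fin n → ℤ) = (c : ℤ) • v - x} ⟨(c : ℤ) • v - x, hy⟩)
    (blowupChart_of_mem Q χ {q : Q | (q : Fin n → ℤ) = v ∨ (q : Fin n → ℤ) = x ∨ (q : Fin n → ℤ) = (c : ℤ) • v - x} ⟨(c : ℤ) • v - x, hy⟩)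
  -- the chart monoid `L ⊕ ℕy ⊕ ℕ(v − y)` is orthant-like
  have hind' : ∀ g ∈ Submodule.span ℤ (faceMonoid P φ 𝔭 : Set (Fin n → ℤ)), ∀ m l : ℤ,
      g + m • ((c : ℤ) • v - x) + l • (v - ((c : ℤ) • v - x)) = 0 → m = 0 ∧ l = 0 := by
    intro g hg m l h
    have h1 : g + (m * (c : ℤ) + l - l * (c : ℤ)) • v + (l - m) • x = 0 := by rw [← h]; module
    have := hind g hg _ _ h1
    constructor
    · have h2 : l = m := by omega
      subst h2
      have h3 : l * (c : ℤ) + l - l * (c : ℤ) = l := by ring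
      rw [h3] at this
      exact this.1
    · have h2 : l = m := by omega
      subst h2
      have h3 : l * (c : ℤ) + l - l * (c : ℤ) = l := by ring
      rw [h3] at this
      exact this.1
  have hspan' : ∀ w : Fin n → ℤ, ∃ g ∈ Submodule.span ℤ (faceMonoid P φ 𝔭 : Set (Fin n → ℤ)),
      ∃ m l : ℤ, w = g + m • ((c : ℤ) • v - x) + l • (v - ((c : ℤ) • v - x)) := by
    intro w
    obtain ⟨g, hg, m, l, rfl⟩ := hspan w
    exact ⟨g, hg, m - l + (c : ℤ) * l, m + (c : ℤ) * l, by module⟩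
  obtain ⟨b, I, hI⟩ := exists_isOrthantLike_of_mem_iff
    (Q := blowupChartMonoid Q {q : Q | (q : Fin n → ℤ) = v ∨ (q : Fin n → ℤ) = x ∨ (q : Fin n → ℤ) = (c : ℤ) • v - x} ⟨(c : ℤ) • v - x, hy⟩) hind' hspan' Finset.univ (fun w => by
      rw [mem_blowupChartMonoid_y_iff hc hQ hind hy w]
      constructor
      · rintro ⟨g, hg, m, l, hm, hl, h⟩; exact ⟨g, hg, m, l, fun _ => hm, fun _ => hl, h⟩
      · rintro ⟨g, hg, m, l, hm, hl, h⟩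
        exact ⟨g, hg, m, l, hm (Finset.mem_univ _), hl (Finset.mem_univ _), h⟩)
  have hreg' : IsLogRegularAt P φ (𝔔.comap (algebraMap A _)) := by
    have key : ∀ (𝔮 : Ideal A) [𝔮.IsPrime], 𝔮 = 𝔭 → IsLogRegularAt P φ 𝔮 := by
      intro 𝔮 _ h; subst h; exact hreg
    exact key _ h𝔔
  exact isRegularLocalRing_localization_of_isOrthantLike hP hsat hspanP hI
    (hPQ.trans (le_blowupChartMonoid Q {q : Q | (q : Fin n → ℤ) = v ∨ (q : Fin n → ℤ) = x ∨ (q : Fin n → ℤ) = (c : ℤ) • v - x} ⟨(c : ℤ) • v - x, hy⟩)) hχ₂ hgen₂ hΩ₂ 𝔔 hreg'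

end Summit.ResolutionOfSingularities.ResolutionOfSingularities.Theorems.FRationalResolution.VertexChartBlowupCharts

end
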